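import Summits.QuantumFields.BalabanUV.Beta.GAN24.ExponentialChartBaseBackgrounds
import Summits.QuantumFields.BalabanUV.Beta.GAN24.CouplingDiagramsAtCoupling
import Summits.QuantumFields.BalabanUV.Beta.GAN24.ResolventMixedPartials

/-!
# `BalabanUV.Beta.GAN24.ExponentialChartBaseCovariantTaylor` — binder row G-an2-4 ∕ (CONV-C), route R7 «TWO CURRENCIES», PART 268: THE ONE-LOOP HESSIAN OF THE EXACT ABELIAN
# COVARIANT VECTOR LAPLACIAN AT A NONZERO SMALL ABELIAN BACKGROUND `U₀ = e^{iηA₀}` — THE MIXED SECOND PARTIAL `∂_r|₀∂_s|₀` OF THE INVERSE EFFECTIVE COVARIANCE ALONG BAŁABAN's CHART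
# `U_{s,r} = exp(iη(A₀ + sA + rB))` — IS FIVE DIAGRAMS WITH PERTURBED PROPAGATORS `(Δ_a + (Δ^{U₀} − Δ^1))⁻¹` AND HAS THE β-CELL's WHOLE `LimitRate` END ON `ℤ^d`, displaying only `(α, β)`
# and EL₁ of the real directions `A_t, B_t`, the constants `(α₀, β₀)` ∕ `(α₀′, β₀′)` of the base connection `−w₀,t = connV U₀,t` and of `z₀,t = zT U₀,t` on the three-condition disc at
# coupling `1`, and EL₁ of `−w₀,t`, `z₀,t` (PART 254 is `A₀ = 0`).  §1 every volume (PART 251's generic mixed partial on PART 266's separate partial jets; invertibility of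
# `Δ_a + (Δ^{U₀} − Δ^1)` and of `c_k(U₀)` displayed); the END is PART 269 `ExponentialChartBaseCovariantTaylorEnd` (PART 264 on the alphabet `Fin 3`)
# (unit b2b-balaban-gan24-p3, gen 67; v1; generator `HOME/b2b-balaban-gan24-p3/gen67/records/gen/gen268.py`)

NOT IN PRINT; OUR PROOF ([folklore] bookkeeping BY NAME over PART 251 (`deriv_deriv_inv_readout_two_param`), PART 266 (`hasDerivAt_covPert_expChartAt₂_fst`, `mixedLetter_base_fst_zero`,
`hasDerivAt_covPert_expChartAt₂_snd_zero`, `hasDerivAt_mixedLetter_base`, `covPert_expChartAt₂_zero_zero`), PART 267 (`lipschitzBackground_baseJetV ∕ _baseMixedJetV`,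
`boundedBackground_baseJetZ ∕ _baseMixedJetZ`, `basePhase_eq`, `baseConjPhase_eq`), PART 264 (`conv_couplingDiagramSumAt_of_tendsto_background`), PART 249
(`opNorm_one_sub_smul_pertCov_le_coupling`), PART 236 (`perturbationLaws_couplingLetter`), PART 161 (`exists_clm_avgTow`), NE2's `covPert_eq`, `isUnit_det_add_smul_right`,
`isUnit_one_add_of_opNorm_lt_one`, `one_sub_smul_reindex`, `opNorm_reindex`; Mathlib's `Fin.sum_univ_five`, `Matrix.det_smul`, `isUnit_of_mul_isUnit_right`;
[Balaban1985BackgroundPropagators] (3.3) p. 390, (3.35) p. 396 and [Balaban1987RG1] (1.20)–(1.22) p. 264 LOCATE the shapes; nothing printed is a hypothesis).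
HONEST FRAMING (cell contract, verbatim): «discharging `BetaPertH` makes Bałaban's UV stability UNCONDITIONAL — a real constructive-QFT result; it is NOT the
continuum limit and NOT the Clay problem.»  HONEST DEPENDENCY (verbatim): «continuum YM on T⁴ ⇐ BetaPertH ∧ nine spine estimates (0/9 proved); BetaPertH ⇐
(D1) ∧ (D4) ∧ CAP+tail; G-an2-4 gates asym, D1 and NE2/3/4.»

WHAT THIS FILE PROVES (0 sorry, 0 `def`; `U_{s,r} = exp(I·A₀∕n + (I·A∕n)·s + (I·B∕n)·r)`, `U₀ = exp(I·A₀∕n)`, `A₀, A, B` REAL):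
* §0 `isUnit_det_of_norm_one_sub_smul_lt` (a Neumann-ratio invertibility letter).
* §1 **`deriv_deriv_invCov_expChartAt₂_eq_mixedDiagram`** (every volume `M`, every level `k`; `Δ_a + (Δ^{U₀} − Δ^1)` and `c_k(U₀)` invertible — displayed):
  `∂_r|₀∂_s|₀[(L^{dk}Q_k(Δ_a^{(k)} + (Δ^{U_{s,r}} − Δ^1))⁻¹Q_kᴴ)⁻¹] = E₀X_bE₀X_aE₀ + E₀X_aE₀X_bE₀ − E₀X_{ba}E₀ − E₀X_{ab}E₀ + E₀X_cE₀`, `E₀ = c_k(U₀)⁻¹`, words in the PERTURBED propagator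
  and the twisted letters `a = P(−iAe^{θ₀}) + P(−iAe^{θ₀})ᴴ + diag(−nΣ_ν(iA_ν)(e^{θ₀,ν} − e^{−θ₀,ν}))`, `b` likewise, `c = P(−(iA)(iB∕n)e^{θ₀}) + ⋯ᴴ + diag(−Σ_ν(iA_ν)(iB_ν)(e^{θ₀,ν} + e^{−θ₀,ν}))`.
WHAT IT DOES NOT DO: the END (PART 269 `ExponentialChartBaseCovariantTaylorEnd`, over PART 264); base connections outside the disc (large fields); colour; Bałaban's `−∂P∂*` ∕ `aQ(U)*Q(U)` parts; the identification with row an1's `Π⁰_{k+1}`.  SUPPLIER work;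
NEVER «G-an2-4 closed»; NOT (CONV-C), NOT D1, NOT `BetaPertH`, NOT continuum, NOT Clay.  Records: `HOME/b2b-balaban-gan24-p3/gen67/README.md`.
-/

noncomputable section

open scoped BigOperators ComplexConjugate Matrix Matrix.Norms.L2Operator
open Filter Topology

namespace Summit.QuantumFields.BalabanUV.Beta.GAN24.ExponentialChartBaseCovariantTaylor

open Literature.MathematicalPhysics.QuantumFieldTheory.Balaban1983to89
open Literature.MathematicalPhysics.QuantumFieldTheory.Balaban1983to89.B5Prop11Plancherel (Tor fine Cst Cst_nonneg opNorm_reindex)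
open Literature.MathematicalPhysics.QuantumFieldTheory.Balaban1983to89.B5G183RateUnitTower (lev)
open Literature.MathematicalPhysics.QuantumFieldTheory.Balaban1983to89.B12Sec2to5 (betaPrime510)
open Literature.MathematicalPhysics.QuantumFieldTheory.Balaban1983to89.Beta (Site IsInfiniteVolumeLimit)
open Literature.MathematicalPhysics.QuantumFieldTheory.Balaban1983to89.Beta.FreeLegDictionary (cubic)
open Literature.MathematicalPhysics.QuantumFieldTheory.Balaban1983to89.Beta.BlockKernelVolumeSockets (evenPeriod)
open Literature.MathematicalPhysics.QuantumFieldTheory.Balaban1983to89.Beta.VectorTails (castT)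
open Literature.MathematicalPhysics.QuantumFieldTheory.Balaban1983to89.Beta.LimitRate (StepRate limKernelOf KernelInputs)
open Summit.QuantumFields.BalabanUV.T4Continuum
open Summit.QuantumFields.BalabanUV.T4Continuum.CovariantAveragingTower (avgTow)
open Summit.QuantumFields.BalabanUV.T4Continuum.BalabanAveragedTowerUnit (idx QBlev)
open Summit.QuantumFields.BalabanUV.T4Continuum.BalabanAveragedCoerciveTower (unitIdx)
open Summit.QuantumFields.BalabanUV.T4Continuum.BalabanAveragedCoercive (gammaB gammaB_pos)
open Summit.QuantumFields.BalabanUV.T4Continuum.KingPairingPlantedLaw (calDalev isUnit_det_calDalev)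
open Summit.QuantumFields.BalabanUV.T4Continuum.FirstOrderBackgroundModel (LipschitzBackground Pmodel)
open Summit.QuantumFields.BalabanUV.T4Continuum.PerturbationAlgebra (BoundedBackground)
open Summit.QuantumFields.BalabanUV.T4Continuum.AbelianCovariantLaplacian (covPert covPert_eq connV zT)
open Summit.QuantumFields.BalabanUV.T4Continuum.BackgroundResolventLaw (isUnit_det_add_smul_right isUnit_one_add_of_opNorm_lt_one)
open Summit.QuantumFields.BalabanUV.T4Continuum.CTConjugatedHbd (G2)
open Summit.QuantumFields.BalabanUV.T4Continuum.DirichletRegionTower (gamD)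
open Summit.QuantumFields.BalabanUV.T4Continuum.ScalarAveragedPropagator (gammaPs)
open Summit.QuantumFields.BalabanUV.T4Continuum.ScalarAveragedCompression (sigma0)
open Summit.QuantumFields.BalabanUV.T4Continuum.CTScalarGreen (Jfree)
open Summit.QuantumFields.BalabanUV.T4Continuum.CTGaugeTerm (deltaK)
open Summit.QuantumFields.BalabanUV.T4Continuum.CTVectorPropagator (JA)
open Summit.QuantumFields.BalabanUV.Beta.GAN24.VolumeLimitCovariance (one_sub_smul_reindex)
open Summit.QuantumFields.BalabanUV.Beta.GAN24.BackgroundExpansionTaylor (exists_clm_avgTow)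
open Summit.QuantumFields.BalabanUV.Beta.GAN24.ResolventMixedPartials (deriv_deriv_inv_readout_two_param)
open Summit.QuantumFields.BalabanUV.Beta.GAN24.CouplingLetterStencil (perturbationLaws_couplingLetter)
open Summit.QuantumFields.BalabanUV.Beta.GAN24.CouplingPerturbedVolumeLimit (opNorm_one_sub_smul_pertCov_le_coupling)
open Summit.QuantumFields.BalabanUV.Beta.GAN24.CouplingDiagramsAtCoupling (conv_couplingDiagramSumAt_of_tendsto_background)
open Summit.QuantumFields.BalabanUV.Beta.GAN24.ExponentialChartBaseMixedJets (hasDerivAt_covPert_expChartAt₂_fst mixedLetter_base_fst_zero hasDerivAt_covPert_expChartAt₂_snd_zero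
  hasDerivAt_mixedLetter_base covPert_expChartAt₂_zero_zero)
open Summit.QuantumFields.BalabanUV.Beta.GAN24.ExponentialChartMixedBackgrounds (lipschitzBackground_mono boundedBackground_mono)
open Summit.QuantumFields.BalabanUV.Beta.GAN24.ExponentialChartBaseBackgrounds (lipschitzBackground_baseJetV lipschitzBackground_baseMixedJetV boundedBackground_baseJetZ
  boundedBackground_baseMixedJetZ basePhase_eq baseConjPhase_eq)

variable {d : ℕ} (L : ℕ) [NeZero L]

/-! ## §0 A Neumann-ratio invertibility letter -/

omit [NeZero L] in
/-- `‖1 − c•X‖ < 1` with `c ≠ 0` ⟹ `det X` is a unit (`c•X = 1 + (c•X − 1)` is a unit by NE2's `isUnit_one_add_of_opNorm_lt_one`; `det(c•X) = c^n·det X`). [folklore] -/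
theorem isUnit_det_of_norm_one_sub_smul_lt {ι : Type*} [Fintype ι] [DecidableEq ι] {X : Matrix ι ι ℂ} {c : ℂ} (h : ‖(1 : Matrix ι ι ℂ) - c • X‖ < 1) :
    IsUnit X.det := by
  have h1 : IsUnit ((1 : Matrix ι ι ℂ) + -(1 - c • X)) := isUnit_one_add_of_opNorm_lt_one (by rwa [norm_neg])
  rw [show (1 : Matrix ι ι ℂ) + -(1 - c • X) = c • X by abel, Matrix.isUnit_iff_isUnit_det, Matrix.det_smul] at h1
  exact isUnit_of_mul_isUnit_right h1

/-! ## §1 The mixed partial at the base point is the explicit five-diagram combination with perturbed propagators (every volume, every level) -/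

section Single

variable (M : Fin d → ℕ) [hM : ∀ μ, NeZero (M μ)] (a : ℝ) (ha : 0 < a)

/-- **`deriv_deriv_invCov_expChartAt₂_eq_mixedDiagram` — THE ONE-LOOP HESSIAN AT `U₀` AS FIVE DIAGRAMS WITH PERTURBED PROPAGATORS** [our proof]: for every volume, every level `k`, REAL
`A₀, A, B`, whenever `Δ_a^{(k)} + (Δ^{U₀} − Δ^1)^{(k)}` and `c_k(U₀) = L^{dk}Q_k(Δ_a + (Δ^{U₀} − Δ^1))⁻¹Q_kᴴ` are invertible (displayed; §2 discharges both on the disc), the mixed partial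
`∂_r|₀∂_s|₀` of `(L^{dk}Q_k(Δ_a^{(k)} + (Δ^{U_{s,r}} − Δ^1))⁻¹Q_kᴴ)⁻¹`, `U_{s,r} = exp(iη(A₀ + sA + rB))`, equals `E₀X_bE₀X_aE₀ + E₀X_aE₀X_bE₀ − E₀X_{ba}E₀ − E₀X_{ab}E₀ + E₀X_cE₀`
with `E₀ = c_k(U₀)⁻¹`, the words in the PERTURBED propagator `(Δ_a + (Δ^{U₀} − Δ^1))⁻¹` and PART 266's twisted letters (PART 251's `deriv_deriv_inv_readout_two_param` at the
base `D = Δ_a`, `P(s, r) = Δ^{U_{s,r}} − Δ^1`, `P(0, 0) = Δ^{U₀} − Δ^1`). [cite: Balaban1985BackgroundPropagators, (3.3) p.390, (3.35) p.396 (shapes); Balaban1987RG1, (1.20)–(1.22) p.264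
      (shapes)] -/
theorem deriv_deriv_invCov_expChartAt₂_eq_mixedDiagram (A₀ A B : (k : ℕ) → Fin d → (idx L M k → ℝ)) (k : ℕ)
    (h0 : IsUnit (calDalev L M a ha k + covPert L M (fun k'' ν' (x' : idx L M k'') => Complex.exp (Complex.I * (A₀ k'' ν' x' : ℂ) / ((lev L k'' : ℕ) : ℂ))) k).det)
    (hc0 : IsUnit (avgTow (QBlev L M) ((L : ℝ) ^ d) (fun k' => (calDalev L M a ha k' + covPert L M (fun k'' ν' (x' : idx L M k'') => Complex.exp (Complex.I * (A₀ k'' ν' x' : ℂ) / ((lev L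
          k'' : ℕ) : ℂ))) k')⁻¹) k).det) :
    deriv (fun r : ℝ => deriv (fun s : ℝ => (avgTow (QBlev L M) ((L : ℝ) ^ d)
        (fun k' => (calDalev L M a ha k' + covPert L M (fun k'' ν' (x' : idx L M k'') => Complex.exp (Complex.I * (A₀ k'' ν' x' : ℂ) / ((lev L k'' : ℕ) : ℂ) + (Complex.I * (A k'' ν' x' : ℂ)
              / ((lev L k'' : ℕ) : ℂ)) * ((s : ℝ) : ℂ) + (Complex.I * (B k'' ν' x' : ℂ) / ((lev L k'' : ℕ) : ℂ)) * ((r : ℝ) : ℂ))) k')⁻¹) k)⁻¹) 0) 0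
      =
      (avgTow (QBlev L M) ((L : ℝ) ^ d) (fun k' => (calDalev L M a ha k' + covPert L M (fun k'' ν' (x' : idx L M k'') => Complex.exp (Complex.I * (A₀ k'' ν' x' : ℂ) / ((lev L k'' : ℕ) :
            ℂ))) k')⁻¹) k)⁻¹
          * avgTow (QBlev L M) ((L : ℝ) ^ d) (fun k' => (calDalev L M a ha k' + covPert L M (fun k'' ν' (x' : idx L M k'') => Complex.exp (Complex.I * (A₀ k'' ν' x' : ℂ) / ((lev L k'' : ℕ)
                : ℂ))) k')⁻¹ * (Pmodel L M (fun k'' ν' (x' : idx L M k'') => -(Complex.I * (B k'' ν' x' : ℂ)) * Complex.exp (Complex.I * (A₀ k'' ν' x' : ℂ) / ((lev L k'' : ℕ) : ℂ))) k' +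
                (Pmodel L M (fun k'' ν' (x' : idx L M k'') => -(Complex.I * (B k'' ν' x' : ℂ)) * Complex.exp (Complex.I * (A₀ k'' ν' x' : ℂ) / ((lev L k'' : ℕ) : ℂ))) k')ᴴ + Matrix.diagonal
                ((fun (k'' : ℕ) (x' : idx L M k'') => -((lev L k'' : ℕ) : ℂ) * ∑ ν, (Complex.I * (B k'' ν x' : ℂ)) * (Complex.exp (Complex.I * (A₀ k'' ν x' : ℂ) / ((lev L k'' : ℕ) : ℂ)) -
                Complex.exp (-(Complex.I * (A₀ k'' ν x' : ℂ) / ((lev L k'' : ℕ) : ℂ))))) k')) * (calDalev L M a ha k' + covPert L M (fun k'' ν' (x' : idx L M k'') => Complex.exp (Complex.I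
                * (A₀ k'' ν' x' : ℂ) / ((lev L k'' : ℕ) : ℂ))) k')⁻¹) k
          * (avgTow (QBlev L M) ((L : ℝ) ^ d) (fun k' => (calDalev L M a ha k' + covPert L M (fun k'' ν' (x' : idx L M k'') => Complex.exp (Complex.I * (A₀ k'' ν' x' : ℂ) / ((lev L k'' : ℕ)
                : ℂ))) k')⁻¹) k)⁻¹
          * avgTow (QBlev L M) ((L : ℝ) ^ d) (fun k' => (calDalev L M a ha k' + covPert L M (fun k'' ν' (x' : idx L M k'') => Complex.exp (Complex.I * (A₀ k'' ν' x' : ℂ) / ((lev L k'' : ℕ)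
                : ℂ))) k')⁻¹ * (Pmodel L M (fun k'' ν' (x' : idx L M k'') => -(Complex.I * (A k'' ν' x' : ℂ)) * Complex.exp (Complex.I * (A₀ k'' ν' x' : ℂ) / ((lev L k'' : ℕ) : ℂ))) k' +
                (Pmodel L M (fun k'' ν' (x' : idx L M k'') => -(Complex.I * (A k'' ν' x' : ℂ)) * Complex.exp (Complex.I * (A₀ k'' ν' x' : ℂ) / ((lev L k'' : ℕ) : ℂ))) k')ᴴ + Matrix.diagonal
                ((fun (k'' : ℕ) (x' : idx L M k'') => -((lev L k'' : ℕ) : ℂ) * ∑ ν, (Complex.I * (A k'' ν x' : ℂ)) * (Complex.exp (Complex.I * (A₀ k'' ν x' : ℂ) / ((lev L k'' : ℕ) : ℂ)) -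
                Complex.exp (-(Complex.I * (A₀ k'' ν x' : ℂ) / ((lev L k'' : ℕ) : ℂ))))) k')) * (calDalev L M a ha k' + covPert L M (fun k'' ν' (x' : idx L M k'') => Complex.exp (Complex.I
                * (A₀ k'' ν' x' : ℂ) / ((lev L k'' : ℕ) : ℂ))) k')⁻¹) k
          * (avgTow (QBlev L M) ((L : ℝ) ^ d) (fun k' => (calDalev L M a ha k' + covPert L M (fun k'' ν' (x' : idx L M k'') => Complex.exp (Complex.I * (A₀ k'' ν' x' : ℂ) / ((lev L k'' : ℕ)
                : ℂ))) k')⁻¹) k)⁻¹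
        + (avgTow (QBlev L M) ((L : ℝ) ^ d) (fun k' => (calDalev L M a ha k' + covPert L M (fun k'' ν' (x' : idx L M k'') => Complex.exp (Complex.I * (A₀ k'' ν' x' : ℂ) / ((lev L k'' : ℕ) :
              ℂ))) k')⁻¹) k)⁻¹
          * avgTow (QBlev L M) ((L : ℝ) ^ d) (fun k' => (calDalev L M a ha k' + covPert L M (fun k'' ν' (x' : idx L M k'') => Complex.exp (Complex.I * (A₀ k'' ν' x' : ℂ) / ((lev L k'' : ℕ)
                : ℂ))) k')⁻¹ * (Pmodel L M (fun k'' ν' (x' : idx L M k'') => -(Complex.I * (A k'' ν' x' : ℂ)) * Complex.exp (Complex.I * (A₀ k'' ν' x' : ℂ) / ((lev L k'' : ℕ) : ℂ))) k' +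
                (Pmodel L M (fun k'' ν' (x' : idx L M k'') => -(Complex.I * (A k'' ν' x' : ℂ)) * Complex.exp (Complex.I * (A₀ k'' ν' x' : ℂ) / ((lev L k'' : ℕ) : ℂ))) k')ᴴ + Matrix.diagonal
                ((fun (k'' : ℕ) (x' : idx L M k'') => -((lev L k'' : ℕ) : ℂ) * ∑ ν, (Complex.I * (A k'' ν x' : ℂ)) * (Complex.exp (Complex.I * (A₀ k'' ν x' : ℂ) / ((lev L k'' : ℕ) : ℂ)) -
                Complex.exp (-(Complex.I * (A₀ k'' ν x' : ℂ) / ((lev L k'' : ℕ) : ℂ))))) k')) * (calDalev L M a ha k' + covPert L M (fun k'' ν' (x' : idx L M k'') => Complex.exp (Complex.I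
                * (A₀ k'' ν' x' : ℂ) / ((lev L k'' : ℕ) : ℂ))) k')⁻¹) k
          * (avgTow (QBlev L M) ((L : ℝ) ^ d) (fun k' => (calDalev L M a ha k' + covPert L M (fun k'' ν' (x' : idx L M k'') => Complex.exp (Complex.I * (A₀ k'' ν' x' : ℂ) / ((lev L k'' : ℕ)
                : ℂ))) k')⁻¹) k)⁻¹
          * avgTow (QBlev L M) ((L : ℝ) ^ d) (fun k' => (calDalev L M a ha k' + covPert L M (fun k'' ν' (x' : idx L M k'') => Complex.exp (Complex.I * (A₀ k'' ν' x' : ℂ) / ((lev L k'' : ℕ)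
                : ℂ))) k')⁻¹ * (Pmodel L M (fun k'' ν' (x' : idx L M k'') => -(Complex.I * (B k'' ν' x' : ℂ)) * Complex.exp (Complex.I * (A₀ k'' ν' x' : ℂ) / ((lev L k'' : ℕ) : ℂ))) k' +
                (Pmodel L M (fun k'' ν' (x' : idx L M k'') => -(Complex.I * (B k'' ν' x' : ℂ)) * Complex.exp (Complex.I * (A₀ k'' ν' x' : ℂ) / ((lev L k'' : ℕ) : ℂ))) k')ᴴ + Matrix.diagonal
                ((fun (k'' : ℕ) (x' : idx L M k'') => -((lev L k'' : ℕ) : ℂ) * ∑ ν, (Complex.I * (B k'' ν x' : ℂ)) * (Complex.exp (Complex.I * (A₀ k'' ν x' : ℂ) / ((lev L k'' : ℕ) : ℂ)) -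
                Complex.exp (-(Complex.I * (A₀ k'' ν x' : ℂ) / ((lev L k'' : ℕ) : ℂ))))) k')) * (calDalev L M a ha k' + covPert L M (fun k'' ν' (x' : idx L M k'') => Complex.exp (Complex.I
                * (A₀ k'' ν' x' : ℂ) / ((lev L k'' : ℕ) : ℂ))) k')⁻¹) k
          * (avgTow (QBlev L M) ((L : ℝ) ^ d) (fun k' => (calDalev L M a ha k' + covPert L M (fun k'' ν' (x' : idx L M k'') => Complex.exp (Complex.I * (A₀ k'' ν' x' : ℂ) / ((lev L k'' : ℕ)
                : ℂ))) k')⁻¹) k)⁻¹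
        - (avgTow (QBlev L M) ((L : ℝ) ^ d) (fun k' => (calDalev L M a ha k' + covPert L M (fun k'' ν' (x' : idx L M k'') => Complex.exp (Complex.I * (A₀ k'' ν' x' : ℂ) / ((lev L k'' : ℕ) :
              ℂ))) k')⁻¹) k)⁻¹
          * avgTow (QBlev L M) ((L : ℝ) ^ d) (fun k' => (calDalev L M a ha k' + covPert L M (fun k'' ν' (x' : idx L M k'') => Complex.exp (Complex.I * (A₀ k'' ν' x' : ℂ) / ((lev L k'' : ℕ)
                : ℂ))) k')⁻¹ * (Pmodel L M (fun k'' ν' (x' : idx L M k'') => -(Complex.I * (B k'' ν' x' : ℂ)) * Complex.exp (Complex.I * (A₀ k'' ν' x' : ℂ) / ((lev L k'' : ℕ) : ℂ))) k' +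
                (Pmodel L M (fun k'' ν' (x' : idx L M k'') => -(Complex.I * (B k'' ν' x' : ℂ)) * Complex.exp (Complex.I * (A₀ k'' ν' x' : ℂ) / ((lev L k'' : ℕ) : ℂ))) k')ᴴ + Matrix.diagonal
                ((fun (k'' : ℕ) (x' : idx L M k'') => -((lev L k'' : ℕ) : ℂ) * ∑ ν, (Complex.I * (B k'' ν x' : ℂ)) * (Complex.exp (Complex.I * (A₀ k'' ν x' : ℂ) / ((lev L k'' : ℕ) : ℂ)) -
                Complex.exp (-(Complex.I * (A₀ k'' ν x' : ℂ) / ((lev L k'' : ℕ) : ℂ))))) k'))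
            * ((calDalev L M a ha k' + covPert L M (fun k'' ν' (x' : idx L M k'') => Complex.exp (Complex.I * (A₀ k'' ν' x' : ℂ) / ((lev L k'' : ℕ) : ℂ))) k')⁻¹ * (Pmodel L M (fun k'' ν'
                  (x' : idx L M k'') => -(Complex.I * (A k'' ν' x' : ℂ)) * Complex.exp (Complex.I * (A₀ k'' ν' x' : ℂ) / ((lev L k'' : ℕ) : ℂ))) k' + (Pmodel L M (fun k'' ν' (x' : idx L M
                  k'') => -(Complex.I * (A k'' ν' x' : ℂ)) * Complex.exp (Complex.I * (A₀ k'' ν' x' : ℂ) / ((lev L k'' : ℕ) : ℂ))) k')ᴴ + Matrix.diagonal ((fun (k'' : ℕ) (x' : idx L M k'')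
                  => -((lev L k'' : ℕ) : ℂ) * ∑ ν, (Complex.I * (A k'' ν x' : ℂ)) * (Complex.exp (Complex.I * (A₀ k'' ν x' : ℂ) / ((lev L k'' : ℕ) : ℂ)) - Complex.exp (-(Complex.I * (A₀ k''
                  ν x' : ℂ) / ((lev L k'' : ℕ) : ℂ))))) k')) * (calDalev L M a ha k' + covPert L M (fun k'' ν' (x' : idx L M k'') => Complex.exp (Complex.I * (A₀ k'' ν' x' : ℂ) / ((lev L
                  k'' : ℕ) : ℂ))) k')⁻¹)) k
          * (avgTow (QBlev L M) ((L : ℝ) ^ d) (fun k' => (calDalev L M a ha k' + covPert L M (fun k'' ν' (x' : idx L M k'') => Complex.exp (Complex.I * (A₀ k'' ν' x' : ℂ) / ((lev L k'' : ℕ)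
                : ℂ))) k')⁻¹) k)⁻¹
        - (avgTow (QBlev L M) ((L : ℝ) ^ d) (fun k' => (calDalev L M a ha k' + covPert L M (fun k'' ν' (x' : idx L M k'') => Complex.exp (Complex.I * (A₀ k'' ν' x' : ℂ) / ((lev L k'' : ℕ) :
              ℂ))) k')⁻¹) k)⁻¹
          * avgTow (QBlev L M) ((L : ℝ) ^ d) (fun k' => (calDalev L M a ha k' + covPert L M (fun k'' ν' (x' : idx L M k'') => Complex.exp (Complex.I * (A₀ k'' ν' x' : ℂ) / ((lev L k'' : ℕ)
                : ℂ))) k')⁻¹ * (Pmodel L M (fun k'' ν' (x' : idx L M k'') => -(Complex.I * (A k'' ν' x' : ℂ)) * Complex.exp (Complex.I * (A₀ k'' ν' x' : ℂ) / ((lev L k'' : ℕ) : ℂ))) k' +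
                (Pmodel L M (fun k'' ν' (x' : idx L M k'') => -(Complex.I * (A k'' ν' x' : ℂ)) * Complex.exp (Complex.I * (A₀ k'' ν' x' : ℂ) / ((lev L k'' : ℕ) : ℂ))) k')ᴴ + Matrix.diagonal
                ((fun (k'' : ℕ) (x' : idx L M k'') => -((lev L k'' : ℕ) : ℂ) * ∑ ν, (Complex.I * (A k'' ν x' : ℂ)) * (Complex.exp (Complex.I * (A₀ k'' ν x' : ℂ) / ((lev L k'' : ℕ) : ℂ)) -
                Complex.exp (-(Complex.I * (A₀ k'' ν x' : ℂ) / ((lev L k'' : ℕ) : ℂ))))) k'))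
            * ((calDalev L M a ha k' + covPert L M (fun k'' ν' (x' : idx L M k'') => Complex.exp (Complex.I * (A₀ k'' ν' x' : ℂ) / ((lev L k'' : ℕ) : ℂ))) k')⁻¹ * (Pmodel L M (fun k'' ν'
                  (x' : idx L M k'') => -(Complex.I * (B k'' ν' x' : ℂ)) * Complex.exp (Complex.I * (A₀ k'' ν' x' : ℂ) / ((lev L k'' : ℕ) : ℂ))) k' + (Pmodel L M (fun k'' ν' (x' : idx L M
                  k'') => -(Complex.I * (B k'' ν' x' : ℂ)) * Complex.exp (Complex.I * (A₀ k'' ν' x' : ℂ) / ((lev L k'' : ℕ) : ℂ))) k')ᴴ + Matrix.diagonal ((fun (k'' : ℕ) (x' : idx L M k'')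
                  => -((lev L k'' : ℕ) : ℂ) * ∑ ν, (Complex.I * (B k'' ν x' : ℂ)) * (Complex.exp (Complex.I * (A₀ k'' ν x' : ℂ) / ((lev L k'' : ℕ) : ℂ)) - Complex.exp (-(Complex.I * (A₀ k''
                  ν x' : ℂ) / ((lev L k'' : ℕ) : ℂ))))) k')) * (calDalev L M a ha k' + covPert L M (fun k'' ν' (x' : idx L M k'') => Complex.exp (Complex.I * (A₀ k'' ν' x' : ℂ) / ((lev L
                  k'' : ℕ) : ℂ))) k')⁻¹)) k
          * (avgTow (QBlev L M) ((L : ℝ) ^ d) (fun k' => (calDalev L M a ha k' + covPert L M (fun k'' ν' (x' : idx L M k'') => Complex.exp (Complex.I * (A₀ k'' ν' x' : ℂ) / ((lev L k'' : ℕ)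
                : ℂ))) k')⁻¹) k)⁻¹
        + (avgTow (QBlev L M) ((L : ℝ) ^ d) (fun k' => (calDalev L M a ha k' + covPert L M (fun k'' ν' (x' : idx L M k'') => Complex.exp (Complex.I * (A₀ k'' ν' x' : ℂ) / ((lev L k'' : ℕ) :
              ℂ))) k')⁻¹) k)⁻¹
          * avgTow (QBlev L M) ((L : ℝ) ^ d) (fun k' => (calDalev L M a ha k' + covPert L M (fun k'' ν' (x' : idx L M k'') => Complex.exp (Complex.I * (A₀ k'' ν' x' : ℂ) / ((lev L k'' : ℕ)
                : ℂ))) k')⁻¹ * (Pmodel L M (fun k'' ν' (x' : idx L M k'') => -(Complex.I * (A k'' ν' x' : ℂ)) * (Complex.I * (B k'' ν' x' : ℂ) / ((lev L k'' : ℕ) : ℂ)) * Complex.exp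
                (Complex.I * (A₀ k'' ν' x' : ℂ) / ((lev L k'' : ℕ) : ℂ))) k' + (Pmodel L M (fun k'' ν' (x' : idx L M k'') => -(Complex.I * (A k'' ν' x' : ℂ)) * (Complex.I * (B k'' ν' x' :
                ℂ) / ((lev L k'' : ℕ) : ℂ)) * Complex.exp (Complex.I * (A₀ k'' ν' x' : ℂ) / ((lev L k'' : ℕ) : ℂ))) k')ᴴ + Matrix.diagonal ((fun (k'' : ℕ) (x' : idx L M k'') => -∑ ν,
                (Complex.I * (A k'' ν x' : ℂ)) * (Complex.I * (B k'' ν x' : ℂ)) * (Complex.exp (Complex.I * (A₀ k'' ν x' : ℂ) / ((lev L k'' : ℕ) : ℂ)) + Complex.exp (-(Complex.I * (A₀ k'' ν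
                x' : ℂ) / ((lev L k'' : ℕ) : ℂ))))) k')) * (calDalev L M a ha k' + covPert L M (fun k'' ν' (x' : idx L M k'') => Complex.exp (Complex.I * (A₀ k'' ν' x' : ℂ) / ((lev L k'' :
                ℕ) : ℂ))) k')⁻¹) k
          * (avgTow (QBlev L M) ((L : ℝ) ^ d) (fun k' => (calDalev L M a ha k' + covPert L M (fun k'' ν' (x' : idx L M k'') => Complex.exp (Complex.I * (A₀ k'' ν' x' : ℂ) / ((lev L k'' : ℕ)
                : ℂ))) k')⁻¹) k)⁻¹ := by
  obtain ⟨Φ, hΦ⟩ := exists_clm_avgTow (QBlev L M) ((L : ℝ) ^ d) k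
  have hF : ∀ s r : ℝ, (avgTow (QBlev L M) ((L : ℝ) ^ d) (fun k' => (calDalev L M a ha k' + covPert L M (fun k'' ν' (x' : idx L M k'') => Complex.exp (Complex.I * (A₀ k'' ν' x' : ℂ) / ((lev
        L k'' : ℕ) : ℂ) + (Complex.I * (A k'' ν' x' : ℂ) / ((lev L k'' : ℕ) : ℂ)) * ((s : ℝ) : ℂ) + (Complex.I * (B k'' ν' x' : ℂ) / ((lev L k'' : ℕ) : ℂ)) * ((r : ℝ) : ℂ))) k')⁻¹) k)⁻¹
      = (Φ (calDalev L M a ha k + covPert L M (fun k'' ν' (x' : idx L M k'') => Complex.exp (Complex.I * (A₀ k'' ν' x' : ℂ) / ((lev L k'' : ℕ) : ℂ) + (Complex.I * (A k'' ν' x' : ℂ) / ((lev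
            L k'' : ℕ) : ℂ)) * ((s : ℝ) : ℂ) + (Complex.I * (B k'' ν' x' : ℂ) / ((lev L k'' : ℕ) : ℂ)) * ((r : ℝ) : ℂ))) k)⁻¹)⁻¹ := fun s r => by
    rw [hΦ]
  simp only [hF]
  have h00 : covPert L M (fun k'' ν' (x' : idx L M k'') => Complex.exp (Complex.I * (A₀ k'' ν' x' : ℂ) / ((lev L k'' : ℕ) : ℂ) + (Complex.I * (A k'' ν' x' : ℂ) / ((lev L k'' : ℕ) : ℂ)) *
        ((0 : ℝ) : ℂ) + (Complex.I * (B k'' ν' x' : ℂ) / ((lev L k'' : ℕ) : ℂ)) * ((0 : ℝ) : ℂ))) k = covPert L M (fun k'' ν' (x' : idx L M k'') => Complex.exp (Complex.I * (A₀ k'' ν' x' :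
        ℂ) / ((lev L k'' : ℕ) : ℂ))) k :=
    covPert_expChartAt₂_zero_zero L M A₀ A B k
  have ec : Φ ((calDalev L M a ha k + covPert L M (fun k'' ν' (x' : idx L M k'') => Complex.exp (Complex.I * (A₀ k'' ν' x' : ℂ) / ((lev L k'' : ℕ) : ℂ))) k)⁻¹) = avgTow (QBlev L M) ((L : ℝ)
        ^ d) (fun k' => (calDalev L M a ha k' + covPert L M (fun k'' ν' (x' : idx L M k'') => Complex.exp (Complex.I * (A₀ k'' ν' x' : ℂ) / ((lev L k'' : ℕ) : ℂ))) k')⁻¹) k :=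
    (hΦ (fun k' => (calDalev L M a ha k' + covPert L M (fun k'' ν' (x' : idx L M k'') => Complex.exp (Complex.I * (A₀ k'' ν' x' : ℂ) / ((lev L k'' : ℕ) : ℂ))) k')⁻¹)).symm
  have h0' : IsUnit (calDalev L M a ha k + covPert L M (fun k'' ν' (x' : idx L M k'') => Complex.exp (Complex.I * (A₀ k'' ν' x' : ℂ) / ((lev L k'' : ℕ) : ℂ) + (Complex.I * (A k'' ν' x' : ℂ)
        / ((lev L k'' : ℕ) : ℂ)) * ((0 : ℝ) : ℂ) + (Complex.I * (B k'' ν' x' : ℂ) / ((lev L k'' : ℕ) : ℂ)) * ((0 : ℝ) : ℂ))) k).det := by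
    rw [h00]
    exact h0
  have hc0' : IsUnit (Φ (calDalev L M a ha k + covPert L M (fun k'' ν' (x' : idx L M k'') => Complex.exp (Complex.I * (A₀ k'' ν' x' : ℂ) / ((lev L k'' : ℕ) : ℂ) + (Complex.I * (A k'' ν' x'
        : ℂ) / ((lev L k'' : ℕ) : ℂ)) * ((0 : ℝ) : ℂ) + (Complex.I * (B k'' ν' x' : ℂ) / ((lev L k'' : ℕ) : ℂ)) * ((0 : ℝ) : ℂ))) k)⁻¹).det := by
    rw [h00, ec]
    exact hc0
  rw [deriv_deriv_inv_readout_two_param (calDalev L M a ha k) Φ (fun r => hasDerivAt_covPert_expChartAt₂_fst L M A₀ A B r k) (mixedLetter_base_fst_zero L M A₀ A B k)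
    (hasDerivAt_covPert_expChartAt₂_snd_zero L M A₀ A B k) (hasDerivAt_mixedLetter_base L M A₀ A B k) h0' hc0']
  -- the base point: `P(0, 0) = Δ^{U₀} − Δ^1`; `Φ` of the perturbed propagator is `c_k(U₀)`; the words through `Φ(X k) = avgTow X k`
  have hX1 : ∀ C : (k' : ℕ) → Matrix (idx L M k') (idx L M k') ℂ,
      Φ ((calDalev L M a ha k + covPert L M (fun k'' ν' (x' : idx L M k'') => Complex.exp (Complex.I * (A₀ k'' ν' x' : ℂ) / ((lev L k'' : ℕ) : ℂ))) k)⁻¹ * C k * (calDalev L M a ha k +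
            covPert L M (fun k'' ν' (x' : idx L M k'') => Complex.exp (Complex.I * (A₀ k'' ν' x' : ℂ) / ((lev L k'' : ℕ) : ℂ))) k)⁻¹) = avgTow (QBlev L M) ((L : ℝ) ^ d) (fun k' => (calDalev
            L M a ha k' + covPert L M (fun k'' ν' (x' : idx L M k'') => Complex.exp (Complex.I * (A₀ k'' ν' x' : ℂ) / ((lev L k'' : ℕ) : ℂ))) k')⁻¹ * C k' * (calDalev L M a ha k' + covPert
            L M (fun k'' ν' (x' : idx L M k'') => Complex.exp (Complex.I * (A₀ k'' ν' x' : ℂ) / ((lev L k'' : ℕ) : ℂ))) k')⁻¹) k :=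
    fun C => (hΦ (fun k' => (calDalev L M a ha k' + covPert L M (fun k'' ν' (x' : idx L M k'') => Complex.exp (Complex.I * (A₀ k'' ν' x' : ℂ) / ((lev L k'' : ℕ) : ℂ))) k')⁻¹ * C k' *
          (calDalev L M a ha k' + covPert L M (fun k'' ν' (x' : idx L M k'') => Complex.exp (Complex.I * (A₀ k'' ν' x' : ℂ) / ((lev L k'' : ℕ) : ℂ))) k')⁻¹)).symm
  have hX2 : ∀ C C' : (k' : ℕ) → Matrix (idx L M k') (idx L M k') ℂ,
      Φ ((calDalev L M a ha k + covPert L M (fun k'' ν' (x' : idx L M k'') => Complex.exp (Complex.I * (A₀ k'' ν' x' : ℂ) / ((lev L k'' : ℕ) : ℂ))) k)⁻¹ * C k * (calDalev L M a ha k +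
            covPert L M (fun k'' ν' (x' : idx L M k'') => Complex.exp (Complex.I * (A₀ k'' ν' x' : ℂ) / ((lev L k'' : ℕ) : ℂ))) k)⁻¹ * C' k * (calDalev L M a ha k + covPert L M (fun k'' ν'
            (x' : idx L M k'') => Complex.exp (Complex.I * (A₀ k'' ν' x' : ℂ) / ((lev L k'' : ℕ) : ℂ))) k)⁻¹)
        = avgTow (QBlev L M) ((L : ℝ) ^ d) (fun k' => (calDalev L M a ha k' + covPert L M (fun k'' ν' (x' : idx L M k'') => Complex.exp (Complex.I * (A₀ k'' ν' x' : ℂ) / ((lev L k'' : ℕ) :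
              ℂ))) k')⁻¹ * C k'
            * ((calDalev L M a ha k' + covPert L M (fun k'' ν' (x' : idx L M k'') => Complex.exp (Complex.I * (A₀ k'' ν' x' : ℂ) / ((lev L k'' : ℕ) : ℂ))) k')⁻¹ * C' k' * (calDalev L M a ha
                  k' + covPert L M (fun k'' ν' (x' : idx L M k'') => Complex.exp (Complex.I * (A₀ k'' ν' x' : ℂ) / ((lev L k'' : ℕ) : ℂ))) k')⁻¹)) k := by
    intro C C'
    rw [show (calDalev L M a ha k + covPert L M (fun k'' ν' (x' : idx L M k'') => Complex.exp (Complex.I * (A₀ k'' ν' x' : ℂ) / ((lev L k'' : ℕ) : ℂ))) k)⁻¹ * C k * (calDalev L M a ha k +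
          covPert L M (fun k'' ν' (x' : idx L M k'') => Complex.exp (Complex.I * (A₀ k'' ν' x' : ℂ) / ((lev L k'' : ℕ) : ℂ))) k)⁻¹ * C' k * (calDalev L M a ha k + covPert L M (fun k'' ν'
          (x' : idx L M k'') => Complex.exp (Complex.I * (A₀ k'' ν' x' : ℂ) / ((lev L k'' : ℕ) : ℂ))) k)⁻¹
        = (calDalev L M a ha k + covPert L M (fun k'' ν' (x' : idx L M k'') => Complex.exp (Complex.I * (A₀ k'' ν' x' : ℂ) / ((lev L k'' : ℕ) : ℂ))) k)⁻¹ * C k * ((calDalev L M a ha k +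
              covPert L M (fun k'' ν' (x' : idx L M k'') => Complex.exp (Complex.I * (A₀ k'' ν' x' : ℂ) / ((lev L k'' : ℕ) : ℂ))) k)⁻¹ * C' k * (calDalev L M a ha k + covPert L M (fun k''
              ν' (x' : idx L M k'') => Complex.exp (Complex.I * (A₀ k'' ν' x' : ℂ) / ((lev L k'' : ℕ) : ℂ))) k)⁻¹) by
      simp only [Matrix.mul_assoc]]
    exact (hΦ (fun k' => (calDalev L M a ha k' + covPert L M (fun k'' ν' (x' : idx L M k'') => Complex.exp (Complex.I * (A₀ k'' ν' x' : ℂ) / ((lev L k'' : ℕ) : ℂ))) k')⁻¹ * C k' *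
          ((calDalev L M a ha k' + covPert L M (fun k'' ν' (x' : idx L M k'') => Complex.exp (Complex.I * (A₀ k'' ν' x' : ℂ) / ((lev L k'' : ℕ) : ℂ))) k')⁻¹ * C' k' * (calDalev L M a ha k'
          + covPert L M (fun k'' ν' (x' : idx L M k'') => Complex.exp (Complex.I * (A₀ k'' ν' x' : ℂ) / ((lev L k'' : ℕ) : ℂ))) k')⁻¹))).symm
  simp only [h00]
  rw [ec]
  rw [hX2 (fun k' => (Pmodel L M (fun k'' ν' (x' : idx L M k'') => -(Complex.I * (B k'' ν' x' : ℂ)) * Complex.exp (Complex.I * (A₀ k'' ν' x' : ℂ) / ((lev L k'' : ℕ) : ℂ))) k' + (Pmodel L M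
        (fun k'' ν' (x' : idx L M k'') => -(Complex.I * (B k'' ν' x' : ℂ)) * Complex.exp (Complex.I * (A₀ k'' ν' x' : ℂ) / ((lev L k'' : ℕ) : ℂ))) k')ᴴ + Matrix.diagonal ((fun (k'' : ℕ) (x'
        : idx L M k'') => -((lev L k'' : ℕ) : ℂ) * ∑ ν, (Complex.I * (B k'' ν x' : ℂ)) * (Complex.exp (Complex.I * (A₀ k'' ν x' : ℂ) / ((lev L k'' : ℕ) : ℂ)) - Complex.exp (-(Complex.I *
        (A₀ k'' ν x' : ℂ) / ((lev L k'' : ℕ) : ℂ))))) k')))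
      (fun k' => (Pmodel L M (fun k'' ν' (x' : idx L M k'') => -(Complex.I * (A k'' ν' x' : ℂ)) * Complex.exp (Complex.I * (A₀ k'' ν' x' : ℂ) / ((lev L k'' : ℕ) : ℂ))) k' + (Pmodel L M (fun
            k'' ν' (x' : idx L M k'') => -(Complex.I * (A k'' ν' x' : ℂ)) * Complex.exp (Complex.I * (A₀ k'' ν' x' : ℂ) / ((lev L k'' : ℕ) : ℂ))) k')ᴴ + Matrix.diagonal ((fun (k'' : ℕ) (x'
            : idx L M k'') => -((lev L k'' : ℕ) : ℂ) * ∑ ν, (Complex.I * (A k'' ν x' : ℂ)) * (Complex.exp (Complex.I * (A₀ k'' ν x' : ℂ) / ((lev L k'' : ℕ) : ℂ)) - Complex.exp (-(Complex.I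
            * (A₀ k'' ν x' : ℂ) / ((lev L k'' : ℕ) : ℂ))))) k'))),
    hX2 (fun k' => (Pmodel L M (fun k'' ν' (x' : idx L M k'') => -(Complex.I * (A k'' ν' x' : ℂ)) * Complex.exp (Complex.I * (A₀ k'' ν' x' : ℂ) / ((lev L k'' : ℕ) : ℂ))) k' + (Pmodel L M
          (fun k'' ν' (x' : idx L M k'') => -(Complex.I * (A k'' ν' x' : ℂ)) * Complex.exp (Complex.I * (A₀ k'' ν' x' : ℂ) / ((lev L k'' : ℕ) : ℂ))) k')ᴴ + Matrix.diagonal ((fun (k'' : ℕ)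
          (x' : idx L M k'') => -((lev L k'' : ℕ) : ℂ) * ∑ ν, (Complex.I * (A k'' ν x' : ℂ)) * (Complex.exp (Complex.I * (A₀ k'' ν x' : ℂ) / ((lev L k'' : ℕ) : ℂ)) - Complex.exp
          (-(Complex.I * (A₀ k'' ν x' : ℂ) / ((lev L k'' : ℕ) : ℂ))))) k')))
      (fun k' => (Pmodel L M (fun k'' ν' (x' : idx L M k'') => -(Complex.I * (B k'' ν' x' : ℂ)) * Complex.exp (Complex.I * (A₀ k'' ν' x' : ℂ) / ((lev L k'' : ℕ) : ℂ))) k' + (Pmodel L M (fun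
            k'' ν' (x' : idx L M k'') => -(Complex.I * (B k'' ν' x' : ℂ)) * Complex.exp (Complex.I * (A₀ k'' ν' x' : ℂ) / ((lev L k'' : ℕ) : ℂ))) k')ᴴ + Matrix.diagonal ((fun (k'' : ℕ) (x'
            : idx L M k'') => -((lev L k'' : ℕ) : ℂ) * ∑ ν, (Complex.I * (B k'' ν x' : ℂ)) * (Complex.exp (Complex.I * (A₀ k'' ν x' : ℂ) / ((lev L k'' : ℕ) : ℂ)) - Complex.exp (-(Complex.I
            * (A₀ k'' ν x' : ℂ) / ((lev L k'' : ℕ) : ℂ))))) k'))),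
    hX1 (fun k' => (Pmodel L M (fun k'' ν' (x' : idx L M k'') => -(Complex.I * (A k'' ν' x' : ℂ)) * Complex.exp (Complex.I * (A₀ k'' ν' x' : ℂ) / ((lev L k'' : ℕ) : ℂ))) k' + (Pmodel L M
          (fun k'' ν' (x' : idx L M k'') => -(Complex.I * (A k'' ν' x' : ℂ)) * Complex.exp (Complex.I * (A₀ k'' ν' x' : ℂ) / ((lev L k'' : ℕ) : ℂ))) k')ᴴ + Matrix.diagonal ((fun (k'' : ℕ)
          (x' : idx L M k'') => -((lev L k'' : ℕ) : ℂ) * ∑ ν, (Complex.I * (A k'' ν x' : ℂ)) * (Complex.exp (Complex.I * (A₀ k'' ν x' : ℂ) / ((lev L k'' : ℕ) : ℂ)) - Complex.exp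
          (-(Complex.I * (A₀ k'' ν x' : ℂ) / ((lev L k'' : ℕ) : ℂ))))) k'))),
    hX1 (fun k' => (Pmodel L M (fun k'' ν' (x' : idx L M k'') => -(Complex.I * (B k'' ν' x' : ℂ)) * Complex.exp (Complex.I * (A₀ k'' ν' x' : ℂ) / ((lev L k'' : ℕ) : ℂ))) k' + (Pmodel L M
          (fun k'' ν' (x' : idx L M k'') => -(Complex.I * (B k'' ν' x' : ℂ)) * Complex.exp (Complex.I * (A₀ k'' ν' x' : ℂ) / ((lev L k'' : ℕ) : ℂ))) k')ᴴ + Matrix.diagonal ((fun (k'' : ℕ)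
          (x' : idx L M k'') => -((lev L k'' : ℕ) : ℂ) * ∑ ν, (Complex.I * (B k'' ν x' : ℂ)) * (Complex.exp (Complex.I * (A₀ k'' ν x' : ℂ) / ((lev L k'' : ℕ) : ℂ)) - Complex.exp
          (-(Complex.I * (A₀ k'' ν x' : ℂ) / ((lev L k'' : ℕ) : ℂ))))) k'))),
    hX1 (fun k' => (Pmodel L M (fun k'' ν' (x' : idx L M k'') => -(Complex.I * (A k'' ν' x' : ℂ)) * (Complex.I * (B k'' ν' x' : ℂ) / ((lev L k'' : ℕ) : ℂ)) * Complex.exp (Complex.I * (A₀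
          k'' ν' x' : ℂ) / ((lev L k'' : ℕ) : ℂ))) k' + (Pmodel L M (fun k'' ν' (x' : idx L M k'') => -(Complex.I * (A k'' ν' x' : ℂ)) * (Complex.I * (B k'' ν' x' : ℂ) / ((lev L k'' : ℕ) :
          ℂ)) * Complex.exp (Complex.I * (A₀ k'' ν' x' : ℂ) / ((lev L k'' : ℕ) : ℂ))) k')ᴴ + Matrix.diagonal ((fun (k'' : ℕ) (x' : idx L M k'') => -∑ ν, (Complex.I * (A k'' ν x' : ℂ)) *
          (Complex.I * (B k'' ν x' : ℂ)) * (Complex.exp (Complex.I * (A₀ k'' ν x' : ℂ) / ((lev L k'' : ℕ) : ℂ)) + Complex.exp (-(Complex.I * (A₀ k'' ν x' : ℂ) / ((lev L k'' : ℕ) : ℂ)))))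
          k')))]

end Single

end Summit.QuantumFields.BalabanUV.Beta.GAN24.ExponentialChartBaseCovariantTaylor

end
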